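import Literature.Geometry.Kaehler.ComplexTorusEllipticProductPicardThreeLattices
import Literature.Geometry.Kaehler.ComplexTorusEllipticProductDecompositionsPicardThree
import HarnessLib

/-!
# Decompositions of a product of two elliptic curves, V: Ma's §4.1 and Theorems 1.2 (2), 1.3 (2) AS PRINTED for
# every decomposable two-dimensional complex torus of Picard number `3` — `NS_X ≅ U ⊕ ⟨-2N⟩`, `T_X ≅ U ⊕ ⟨2N⟩`
# ("`2N = -det(T_X)`"), `N` = the minimal isogeny degree (Prop. 4.1), `δ̃(X) = 2^{τ(N)}`, `δ(X) = 2^{τ(N)-1}`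

Layer `Literature/Geometry/Kaehler`, namespace `Literature.Geometry.Kaehler.ComplexTorus`; lane `lit-hodgefound`
(Track 2 foundations library, Layer A1/A4), seat p18 gen 23, row g23-#1 FILE 4b: the one-step composition of
FILE 4 `ComplexTorusEllipticProductPicardThreeLattices` (the lattices of the normal form `A_N = E_{Nτ} × E_τ`,
transported to every `X ≅ A_N`) with FILE 3 `ComplexTorusEllipticProductDecompositionsPicardThree` (every
decomposable `X` with `ρ(X) = 3` is `≅ A_N`, `N = gd` the minimal degree of an isogeny between the factors,
Prop. 4.1), plus a worked instance.  THEOREMS ONLY — no definition, no named fact (D-0026; net Literature debt `0`).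

## Source, VERBATIM

S. Ma, *Decompositions of an Abelian surface and quadratic forms*, Ann. Inst. Fourier **61** (2011) 717–743
[Ma2011DecompositionsAbelianSurface] (held text `paper:arxiv-0906.0412`, p0003, p0008):
"let `T_A` be the transcendental lattice of `A`, which is the orthogonal complement of the Néron-Severi lattice in
`H²(A, ℤ)`." "**Theorem 1.2.** Let `A` be a decomposable Abelian surface. … (2) When `ρ(A) = 3`, one has
`δ(A) = 2^{τ(N)-1}` where `2N = -det(T_A)`." "**Theorem 1.3.** … (2) If `ρ(A) = 3`, then `δ̃(A) = 1` (`N = 1`),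
`2^{τ(N)}` (`N > 1`), where `2N = -det(T_A)`." (`τ(n)` = the number of prime divisors of `n`, `τ(1) := 1`.)
§4.1: "Let `A` be a decomposable Abelian surface with `ρ(A) = 3`. Then `NS_A ≃ U ⊕ ⟨-2N⟩` for some `N ∈ ℤ_{>0}`.
This natural number `N` may be calculated by (4.1) `N = ½ det(NS_A) = -½ det(T_A)`. … **Proposition 4.1.** Let
`(E₁, E₂)` be a decomposition of `A`. Then `N = min{deg φ | φ : E₁ → E₂ isogeny}`."

## Dictionary

As in FILES 1–4: `X = E/Φ(ℤ^ι)` a two-dimensional complex torus with an ordering `e : Fin 4 ≃ ι` of its lattice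
basis (the datum of `∫_X`), `ρ(X) = finrank ℤ (neronSeveriGroup Φ)`, `NS_X = integralHodgeClasses Φ 1`,
`T_X = transcendentalLattice Φ`, the cup product `∫_X x ∧ y = torusIntegral Φ e (x.wedge y)`; a decomposition of
`X` is a period pair `(ω₁, ω₂)` (`Im > 0`) with `E_{ω₁} × E_{ω₂} ≅ X`; the degree of an isogeny `ρ(A) : E_{τ₁} → E_{τ₂}`
is `Nat.card (ker ρ(A))`; "`L ≅ U ⊕ ⟨m⟩`" is an explicit `ℤ`-basis `b₁, b₂, b₃` of `L` with unique coefficients and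
Gram values `b₁² = 0, b₁b₂ = 1, b₁b₃ = 0, b₂² = 0, b₂b₃ = 0, b₃² = m` (the pairing is symmetric,
`torusIntegral_wedge_two_comm`), whose Gram determinant is `-m` (`det_gram_neronSeveri_transcendental`).

## Contents (all proved)

* §1 **`neronSeveri_transcendental_gram_of_finrank_eq_three`** — for `X ≅ E_{τ₁} × E_{τ₂}` with `ρ(X) = 3`:
  `∃ N ≥ 1`, `NS_X ≅ U ⊕ ⟨-2N⟩`, `T_X ≅ U ⊕ ⟨2N⟩`, and `N` divides and bounds below the degree of every isogeny
  `E_{τ₁} → E_{τ₂}` and is attained (§4.1, (4.1), PROP. 4.1);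
  **`card_decompositions_of_finrank_eq_three_transcendentalLattice`** — THEOREMS 1.3 (2) AND 1.2 (2) AS PRINTED:
  `∃ N ≥ 1` with `T_X ≅ U ⊕ ⟨2N⟩` and, for this `N`, `#Dec = 2^{#primeFactors N}` (`δ̃`), `#DecU = 2^{#primeFactors N - 1}`
  (`δ`).
* §2 instance `τ₀ = i·2^{1/4}` (no complex multiplication, FILE 3 §5): **`transcendentalLattice_natCast_mul_fourthRoot_two`**
  (`T_{E_{Nτ₀} × E_{τ₀}} = ℤε₃₁ ⊕ ℤε₂₄ ⊕ ℤ(ε₂₃ + Nε₁₄)`, `ε₃₁ε₂₄ = 1`, `(ε₂₃ + Nε₁₄)² = 2N`; for `N = 6`, `-det T = 12`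
  next to FILE 3's `δ̃(E_{6τ₀} × E_{τ₀}) = 4 = 2^{τ(6)}`).

## Honest scope — NOT here

As in FILE 4: the basis-independence of the Gram determinant is not re-proved; §4.3 (Atkin–Lehner) is not formalised.

## References

* [Ma2011DecompositionsAbelianSurface] S. Ma, Ann. Inst. Fourier 61 (2011) 717–743 = arXiv:0906.0412: §1 Thm. 1.2 (2),
  Thm. 1.3 (2); §4.1 (4.1), Prop. 4.1, Prop. 4.2; §4.2 Thm. 4.6.
* [ShiodaMitani1974] T. Shioda, N. Mitani, LNM 412 (1974): §1 (1.5), §3 (3.19).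
* [Lange2023AbelianVarietiesComplex] H. Lange (2023): §1.3.4 Exercise (9), §5.1.5 Exercises (1), (2).
-/

noncomputable section

open Module Complex

namespace Literature.Geometry.Kaehler

namespace ComplexTorus

open ShiodaMitani

/-! ## §1 `ρ(X) = 3`: `NS_X ≅ U ⊕ ⟨-2N⟩`, `T_X ≅ U ⊕ ⟨2N⟩`, `N` the minimal isogeny degree; Theorems 1.3 (2), 1.2 (2) -/

section PicardThreeAsPrinted

variable {ι : Type*} [Fintype ι] [DecidableEq ι] {E : Type*} [NormedAddCommGroup E] [NormedSpace ℂ E]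
  {Φ : (ι → ℝ) ≃L[ℝ] E}

/-- **The normal form of a decomposable torus `X` of Picard number `3`, packaged**: `X ≅ A_N = E_{Nτ} × E_τ` with
`τ ∈ ℍ` without complex multiplication and `N ≥ 1` dividing and bounding below the degree of every isogeny
`E_{τ₁} → E_{τ₂}` between the factors of the given decomposition, and attained.
[cite: Ma2011DecompositionsAbelianSurface, §4.1 Prop. 4.1 and §4.2 Prop. 4.5, Thm. 4.6] -/
private theorem exists_normalForm_package (hρ : finrank ℤ (neronSeveriGroup Φ) = 3) {τ₁ τ₂ : ℂ}
    (hτ₁ : 0 < τ₁.im) (hτ₂ : 0 < τ₂.im) (h : IsIsomorphic (prodPeriod (ellipticPeriod hτ₁.ne') (ellipticPeriod hτ₂.ne')) Φ) :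
    ∃ (τ : ℂ) (N : ℕ) (hτ : 0 < τ.im) (hNτ : 0 < ((N : ℂ) * τ).im), (∀ p q : ℚ, τ ^ 2 + p * τ + q ≠ 0) ∧ 0 < N ∧
      IsIsomorphic Φ (prodPeriod (ellipticPeriod hNτ.ne') (ellipticPeriod hτ.ne')) ∧
      ((∀ A : Matrix (Fin 2) (Fin 2) ℤ, IsIsogeny (ellipticPeriod hτ₁.ne') (ellipticPeriod hτ₂.ne') A →
          N ∣ Nat.card (mapMatrixHom (ellipticPeriod hτ₁.ne') (ellipticPeriod hτ₂.ne') A).ker ∧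
            N ≤ Nat.card (mapMatrixHom (ellipticPeriod hτ₁.ne') (ellipticPeriod hτ₂.ne') A).ker) ∧
        ∃ A : Matrix (Fin 2) (Fin 2) ℤ, IsIsogeny (ellipticPeriod hτ₁.ne') (ellipticPeriod hτ₂.ne') A ∧
          Nat.card (mapMatrixHom (ellipticPeriod hτ₁.ne') (ellipticPeriod hτ₂.ne') A).ker = N) := by
  have hρ' : finrank ℤ (neronSeveriGroup (prodPeriod (ellipticPeriod hτ₁.ne') (ellipticPeriod hτ₂.ne'))) = 3 :=
    h.isIsogenous.finrank_neronSeveriGroup_eq.trans hρ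
  obtain ⟨τ, g, d, hτ, hg, hd, hcop, hq, hgτ, hdτ, hNτ, isog, isod, hA⟩ :=
    exists_normalForm_of_finrank_neronSeveriGroup_eq_three hτ₁ hτ₂ hρ'
  have hNpos : 0 < (((g * d : ℕ) : ℂ) * τ).im := by
    rw [mul_im, natCast_re, natCast_im, zero_mul, add_zero]
    exact mul_pos (Nat.cast_pos.mpr (Nat.pos_of_ne_zero (mul_ne_zero hg hd))) hτ
  exact ⟨τ, g * d, hτ, hNpos, hq, Nat.pos_of_ne_zero (mul_ne_zero hg hd), h.symm.trans hA,
    minimal_degree_of_isIsomorphic_natCast_mul hq hcop isog isod⟩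

/-- **MA §4.1 WITH PROPOSITION 4.1, for every decomposable two-dimensional complex torus `X` of Picard number `3`:
`NS_X ≅ U ⊕ ⟨-2N⟩` and `T_X ≅ U ⊕ ⟨2N⟩` — so `N = ½ det(NS_X) = -½ det(T_X)` (4.1) — where `N` is the minimal degree
of an isogeny `E₁ → E₂` between the factors of a decomposition `(E₁, E₂) = (E_{τ₁}, E_{τ₂})` of `X`** (every isogeny
has degree divisible by and at least `N`, and degree `N` is attained).  Each lattice comes with an explicit `ℤ`-basis,
uniqueness of coefficients and its Gram values for the cup product `∫_X x ∧ y`.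
[cite: Ma2011DecompositionsAbelianSurface, §4.1 (`NS_A ≅ U ⊕ ⟨-2N⟩`), (4.1) and Prop. 4.1] -/
theorem neronSeveri_transcendental_gram_of_finrank_eq_three (e : Fin (2 + 2) ≃ ι)
    (hρ : finrank ℤ (neronSeveriGroup Φ) = 3) {τ₁ τ₂ : ℂ} (hτ₁ : 0 < τ₁.im) (hτ₂ : 0 < τ₂.im)
    (h : IsIsomorphic (prodPeriod (ellipticPeriod hτ₁.ne') (ellipticPeriod hτ₂.ne')) Φ) :
    ∃ N : ℕ, 0 < N ∧
      (∃ v₁ v₂ v₃ : E [⋀^Fin 2]→L[ℝ] ℂ,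
        (∀ s, s ∈ integralHodgeClasses Φ 1 ↔ ∃ n₁ n₂ n₃ : ℤ, s = n₁ • v₁ + n₂ • v₂ + n₃ • v₃) ∧
        (∀ n₁ n₂ n₃ : ℂ, n₁ • v₁ + n₂ • v₂ + n₃ • v₃ = 0 → n₁ = 0 ∧ n₂ = 0 ∧ n₃ = 0) ∧
        torusIntegral Φ e (v₁.wedge v₁) = 0 ∧ torusIntegral Φ e (v₁.wedge v₂) = 1 ∧
        torusIntegral Φ e (v₁.wedge v₃) = 0 ∧ torusIntegral Φ e (v₂.wedge v₂) = 0 ∧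
        torusIntegral Φ e (v₂.wedge v₃) = 0 ∧ torusIntegral Φ e (v₃.wedge v₃) = -(2 * (N : ℂ))) ∧
      (∃ u₁ u₂ u₃ : E [⋀^Fin 2]→L[ℝ] ℂ,
        (∀ t, t ∈ transcendentalLattice Φ ↔ ∃ n₁ n₂ n₃ : ℤ, t = n₁ • u₁ + n₂ • u₂ + n₃ • u₃) ∧
        (∀ n₁ n₂ n₃ : ℂ, n₁ • u₁ + n₂ • u₂ + n₃ • u₃ = 0 → n₁ = 0 ∧ n₂ = 0 ∧ n₃ = 0) ∧
        torusIntegral Φ e (u₁.wedge u₁) = 0 ∧ torusIntegral Φ e (u₁.wedge u₂) = 1 ∧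
        torusIntegral Φ e (u₁.wedge u₃) = 0 ∧ torusIntegral Φ e (u₂.wedge u₂) = 0 ∧
        torusIntegral Φ e (u₂.wedge u₃) = 0 ∧ torusIntegral Φ e (u₃.wedge u₃) = 2 * (N : ℂ)) ∧
      ((∀ A : Matrix (Fin 2) (Fin 2) ℤ, IsIsogeny (ellipticPeriod hτ₁.ne') (ellipticPeriod hτ₂.ne') A →
          N ∣ Nat.card (mapMatrixHom (ellipticPeriod hτ₁.ne') (ellipticPeriod hτ₂.ne') A).ker ∧
            N ≤ Nat.card (mapMatrixHom (ellipticPeriod hτ₁.ne') (ellipticPeriod hτ₂.ne') A).ker) ∧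
        ∃ A : Matrix (Fin 2) (Fin 2) ℤ, IsIsogeny (ellipticPeriod hτ₁.ne') (ellipticPeriod hτ₂.ne') A ∧
          Nat.card (mapMatrixHom (ellipticPeriod hτ₁.ne') (ellipticPeriod hτ₂.ne') A).ker = N) := by
  obtain ⟨τ, N, hτ, hNτ, hq, hN, hX, hmin⟩ := exists_normalForm_package hρ hτ₁ hτ₂ h
  obtain ⟨hS, hT⟩ := neronSeveri_transcendental_gram_of_isIsomorphic_natCast_mul e hτ hq hNτ hX
  exact ⟨N, hN, hS, hT, hmin⟩

/-- **MA, THEOREM 1.3 (2) AND THEOREM 1.2 (2) AS PRINTED.**  Let `X` be a decomposable two-dimensional complex torus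
(`X ≅ E_{τ₁} × E_{τ₂}`) with `ρ(X) = 3`.  Then there is `N ≥ 1` with **`T_X ≅ U ⊕ ⟨2N⟩`** — an explicit `ℤ`-basis
`u₁, u₂, u₃` of the transcendental lattice with `u₁u₂ = 1`, `u₃² = 2N`, all other products `0`, so that
**`2N = -det(T_X)`** — and, for THIS `N`: **`δ̃(X) = 2^{τ(N)}` (`N > 1`), `= 1` (`N = 1`)** — the decompositions of `X`
up to strict isomorphism are represented by a set `Dec` of period pairs with `#Dec = 2 ^ #(prime factors of N)` (every
member is a decomposition of `X`; every decomposition `E_{ω₁} × E_{ω₂} ≅ X` is strictly isomorphic to exactly one member)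
— and **`δ(X) = 2^{τ(N)-1}`** (`τ(1) := 1`; truncated subtraction in Lean) — the decompositions up to interchanging the
factors are represented by `DecU` with `#DecU = 2 ^ (#(prime factors of N) - 1)`.
[cite: Ma2011DecompositionsAbelianSurface, §1 Thm. 1.2 (2), Thm. 1.3 (2) ("where `2N = -det(T_A)`"), §4.1 (4.1), Prop. 4.2, §4.2 Thm. 4.6] -/
theorem card_decompositions_of_finrank_eq_three_transcendentalLattice (e : Fin (2 + 2) ≃ ι)
    (hρ : finrank ℤ (neronSeveriGroup Φ) = 3) {τ₁ τ₂ : ℂ} (hτ₁ : 0 < τ₁.im) (hτ₂ : 0 < τ₂.im)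
    (h : IsIsomorphic (prodPeriod (ellipticPeriod hτ₁.ne') (ellipticPeriod hτ₂.ne')) Φ) :
    ∃ N : ℕ, 0 < N ∧
      (∃ u₁ u₂ u₃ : E [⋀^Fin 2]→L[ℝ] ℂ,
        (∀ t, t ∈ transcendentalLattice Φ ↔ ∃ n₁ n₂ n₃ : ℤ, t = n₁ • u₁ + n₂ • u₂ + n₃ • u₃) ∧
        (∀ n₁ n₂ n₃ : ℂ, n₁ • u₁ + n₂ • u₂ + n₃ • u₃ = 0 → n₁ = 0 ∧ n₂ = 0 ∧ n₃ = 0) ∧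
        torusIntegral Φ e (u₁.wedge u₁) = 0 ∧ torusIntegral Φ e (u₁.wedge u₂) = 1 ∧
        torusIntegral Φ e (u₁.wedge u₃) = 0 ∧ torusIntegral Φ e (u₂.wedge u₂) = 0 ∧
        torusIntegral Φ e (u₂.wedge u₃) = 0 ∧ torusIntegral Φ e (u₃.wedge u₃) = 2 * (N : ℂ)) ∧
      (∃ Dec : Finset (ℂ × ℂ), Dec.card = 2 ^ N.primeFactors.card ∧
        (∀ p ∈ Dec, ∃ (h₁ : 0 < p.1.im) (h₂ : 0 < p.2.im),
          IsIsomorphic (prodPeriod (ellipticPeriod h₁.ne') (ellipticPeriod h₂.ne')) Φ) ∧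
        ∀ (ω₁ ω₂ : ℂ) (hω₁ : 0 < ω₁.im) (hω₂ : 0 < ω₂.im),
          IsIsomorphic (prodPeriod (ellipticPeriod hω₁.ne') (ellipticPeriod hω₂.ne')) Φ →
          ∃! p, p ∈ Dec ∧ ∃ (h₁ : 0 < p.1.im) (h₂ : 0 < p.2.im),
            IsIsomorphic (ellipticPeriod hω₁.ne') (ellipticPeriod h₁.ne') ∧
              IsIsomorphic (ellipticPeriod hω₂.ne') (ellipticPeriod h₂.ne')) ∧
      ∃ DecU : Finset (ℂ × ℂ), DecU.card = 2 ^ (N.primeFactors.card - 1) ∧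
        (∀ p ∈ DecU, ∃ (h₁ : 0 < p.1.im) (h₂ : 0 < p.2.im),
          IsIsomorphic (prodPeriod (ellipticPeriod h₁.ne') (ellipticPeriod h₂.ne')) Φ) ∧
        ∀ (ω₁ ω₂ : ℂ) (hω₁ : 0 < ω₁.im) (hω₂ : 0 < ω₂.im),
          IsIsomorphic (prodPeriod (ellipticPeriod hω₁.ne') (ellipticPeriod hω₂.ne')) Φ →
          ∃! p, p ∈ DecU ∧ ∃ (h₁ : 0 < p.1.im) (h₂ : 0 < p.2.im),
            (IsIsomorphic (ellipticPeriod hω₁.ne') (ellipticPeriod h₁.ne') ∧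
                IsIsomorphic (ellipticPeriod hω₂.ne') (ellipticPeriod h₂.ne')) ∨
              (IsIsomorphic (ellipticPeriod hω₁.ne') (ellipticPeriod h₂.ne') ∧
                IsIsomorphic (ellipticPeriod hω₂.ne') (ellipticPeriod h₁.ne')) := by
  obtain ⟨τ, N, hτ, hNτ, hq, hN, hX, -⟩ := exists_normalForm_package hρ hτ₁ hτ₂ h
  exact ⟨N, hN, card_decompositions_of_isIsomorphic_natCast_mul_transcendentalLattice e hτ hq hN hNτ hX⟩

end PicardThreeAsPrinted

/-! ## §2 Instance: the curve `τ₀ = i·2^{1/4}` (no complex multiplication, FILE 3 §5) — `T_{E_{Nτ₀} × E_{τ₀}} ≅ U ⊕ ⟨2N⟩`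
for every `N ≥ 1` (for `N = 6`: `-det T = 12`, matching `δ̃(E_{6τ₀} × E_{τ₀}) = 2^{τ(6)} = 4` of FILE 3) -/

section Instance

/-- `Im τ₀ > 0` for `τ₀ = i·2^{1/4}`. [folklore] -/
private theorem im_I_mul_fourthRoot_two_pos' : 0 < (I * (Real.sqrt (Real.sqrt 2) : ℂ)).im := by
  rw [mul_im, I_re, I_im, ofReal_re, ofReal_im, zero_mul, one_mul, zero_add]
  exact Real.sqrt_pos.mpr (Real.sqrt_pos.mpr two_pos)

/-- **Worked instance: `T_{E_{Nτ₀} × E_{τ₀}} = ℤε₃₁ ⊕ ℤε₂₄ ⊕ ℤ(ε₂₃ + Nε₁₄) ≅ U ⊕ ⟨2N⟩`** for `τ₀ = i·2^{1/4}` and every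
`N ≥ 1` (so `-det T = 2N`; with FILE 3's `card_decompositions_six_mul_fourthRoot_two`, `N = 6` gives `-det T = 12`
and `δ̃ = 2^{τ(6)} = 4`, as Theorem 1.3 (2) predicts). [cite: Ma2011DecompositionsAbelianSurface, §1 Thm. 1.3 (2) and §4.1 (4.1)] -/
theorem transcendentalLattice_natCast_mul_fourthRoot_two {N : ℕ}
    (hN : 0 < ((N : ℂ) * (I * (Real.sqrt (Real.sqrt 2) : ℂ))).im) :
    (∀ t, t ∈ transcendentalLattice (prodPeriod (ellipticPeriod hN.ne') (ellipticPeriod im_I_mul_fourthRoot_two_pos'.ne')) ↔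
        ∃ m₁ m₂ m₃ : ℤ, t =
          m₁ • coordForm (prodPeriod (ellipticPeriod hN.ne') (ellipticPeriod im_I_mul_fourthRoot_two_pos'.ne'))
              (Sum.inr 0) (Sum.inl 0) +
            m₂ • coordForm (prodPeriod (ellipticPeriod hN.ne') (ellipticPeriod im_I_mul_fourthRoot_two_pos'.ne'))
              (Sum.inl 1) (Sum.inr 1) +
            m₃ • (coordForm (prodPeriod (ellipticPeriod hN.ne') (ellipticPeriod im_I_mul_fourthRoot_two_pos'.ne'))
                (Sum.inl 1) (Sum.inr 0) +
              (N : ℂ) • coordForm (prodPeriod (ellipticPeriod hN.ne') (ellipticPeriod im_I_mul_fourthRoot_two_pos'.ne'))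
                (Sum.inl 0) (Sum.inr 1))) ∧
      torusIntegral (prodPeriod (ellipticPeriod hN.ne') (ellipticPeriod im_I_mul_fourthRoot_two_pos'.ne')) enum
          ((coordForm (prodPeriod (ellipticPeriod hN.ne') (ellipticPeriod im_I_mul_fourthRoot_two_pos'.ne'))
              (Sum.inr 0) (Sum.inl 0)).wedge
            (coordForm (prodPeriod (ellipticPeriod hN.ne') (ellipticPeriod im_I_mul_fourthRoot_two_pos'.ne'))
              (Sum.inl 1) (Sum.inr 1))) = 1 ∧
      torusIntegral (prodPeriod (ellipticPeriod hN.ne') (ellipticPeriod im_I_mul_fourthRoot_two_pos'.ne')) enum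
          ((coordForm (prodPeriod (ellipticPeriod hN.ne') (ellipticPeriod im_I_mul_fourthRoot_two_pos'.ne'))
                (Sum.inl 1) (Sum.inr 0) +
              (N : ℂ) • coordForm (prodPeriod (ellipticPeriod hN.ne') (ellipticPeriod im_I_mul_fourthRoot_two_pos'.ne'))
                (Sum.inl 0) (Sum.inr 1)).wedge
            (coordForm (prodPeriod (ellipticPeriod hN.ne') (ellipticPeriod im_I_mul_fourthRoot_two_pos'.ne'))
                (Sum.inl 1) (Sum.inr 0) +
              (N : ℂ) • coordForm (prodPeriod (ellipticPeriod hN.ne') (ellipticPeriod im_I_mul_fourthRoot_two_pos'.ne'))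
                (Sum.inl 0) (Sum.inr 1))) = 2 * (N : ℂ) := by
  obtain ⟨-, h12, -, -, -, h33⟩ := gram_transcendental_natCast_mul im_I_mul_fourthRoot_two_pos' hN
  exact ⟨fun t ↦ mem_transcendentalLattice_natCast_mul_iff_exists _ _ forall_ne_I_mul_fourthRoot_two, h12, h33⟩

end Instance

end ComplexTorus

end Literature.Geometry.Kaehler

end
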